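import Summits.PneNP.PneNP.Theses.RootDecompTauLift

/-!
# `RootDecompTauLift.MonotoneRung` (stmt-PneNP-28249) — the decided bottom rung of the τ-lift dial

Node N13 of the decomp-pnenp root-decomposition cell (route `route-PneNP-RootDecompTauLift`) records,
as an aside, the bottom rung of the permanent's restricted-algebraic-model dial: Jerrum–Snir 1982 §4.3,
every monotone computation of `perₙ` has at least `n(2^{n-1} − 1)` product gates.  The item is
VERBATIM the tree's named fact `Literature.Barriers.ValiantsHypothesis.JerrumSnir1982_permanent`,
discharged in the tree by `JerrumSnir1982_permanent_holds` (`MonotoneGapPermanentProofs`).  This file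
is the one-line port owed to the prover lane (TREE debt D12 (b)).  0 sorry.
-/

namespace Summit.PneNP.PneNP.Theorems

/-- The decided rung `MonotoneRung` (stmt-PneNP-28249): Jerrum–Snir's monotone lower bound for the
permanent, i.e. the tree theorem `Literature.Barriers.ValiantsHypothesis.JerrumSnir1982_permanent_holds`
read through the route declaration (decomp-pnenp cell, 2026-08-30). -/
theorem monotoneRung_proof :
    Summit.PneNP.PneNP.Theses.RootDecompTauLift.MonotoneRung := by
  unfold Summit.PneNP.PneNP.Theses.RootDecompTauLift.MonotoneRung
  exact Literature.Barriers.ValiantsHypothesis.JerrumSnir1982_permanent_holds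

end Summit.PneNP.PneNP.Theorems
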